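import Mathlib
import HarnessLib
import Literature.Analysis.Calculus.FiniteOrderIntervalExtension

/-!
# Route `ConnesConsaniSemilocal`, crux `DensityRegular` (item stmt-RiemannHypothesis-19307):
# the registered stub `stub_extend` — a `C²` function on `[0, ∞)` extends to a `C²` function on `ℝ`

RH-FREE (line 1): a pure calculus fact (Whitney's extension theorem in dimension one, case `m = 2`
finite), in the tree as `Literature.Analysis.Calculus.exists_contDiff_two_extension_Ici`
(`FiniteOrderIntervalExtension.lean`, cell row gm-t16 "E1": continue `g` to the left of `0` by its
Taylor polynomial of order `2` at `0⁺`).  bears_on: W-C/W-P (cell rh-crit, corpus C1; route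
`route-RiemannHypothesis-ConnesConsaniSemilocal`, binder K0 `DensityRegular`, birth skeleton
`DensityRegular_of` = `stub_onesided` (the prolate series `x ↦ ε(eˣ)` is `C²` on `[0, ∞)`) ∘
`stub_extend` (this file), registered 2026-08-26T04:25:03Z, skeleton sha16 bb849f676ceb0925).

**The statement** (registered signature, verbatim): every `g : ℝ → ℂ` of class `C²` on `Ici 0` in
Mathlib's within sense is the restriction to `Ici 0` of some `G : ℝ → ℂ` of class `C²` on `ℝ`.  This is
the instance `F = ℂ`, `N = 2`, `a = 0` of the tree theorem (which moreover matches the right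
derivative at `0`, not needed here).

WHAT THIS IS NOT: not the one-sided regularity of the density (`stub_onesided`: App. E/F termwise
`C²` bounds, cell rows t5/t6/gm-t16); not a statement about `ζ`, Weil positivity or RH.  Nothing here
bears on the truth of RH.
-/

set_option linter.dupNamespace false  -- the mandated namespace repeats `RiemannHypothesis`

namespace Summit.RiemannHypothesis.RiemannHypothesis.Theorems.ConnesConsaniSemilocal

open Set

/-- **Registered stub `stub_extend`** of the birth skeleton of crux `DensityRegular` (route
`ConnesConsaniSemilocal`, item stmt-RiemannHypothesis-19307): a function `ℝ → ℂ` that is `C²` on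
`[0, ∞)` (within sense, one-sided derivatives at `0`) agrees on `[0, ∞)` with a `C²` function on `ℝ`.
RH-FREE; the instance `N = 2` of Whitney's one-dimensional extension theorem as held in the tree
(`Literature.Analysis.Calculus.exists_contDiff_two_extension_Ici`). [cite: Whitney1934, Thm. I (case m finite)] -/
theorem stub_extend : ∀ g : ℝ → ℂ, ContDiffOn ℝ 2 g (Ici 0) →
    ∃ G : ℝ → ℂ, ContDiff ℝ 2 G ∧ EqOn G g (Ici 0) := by
  intro g hg
  obtain ⟨G, hG, hGg, -⟩ := Literature.Analysis.Calculus.exists_contDiff_two_extension_Ici hg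
  exact ⟨G, hG, hGg⟩

end Summit.RiemannHypothesis.RiemannHypothesis.Theorems.ConnesConsaniSemilocal
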